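import Summits.RiemannHypothesis.RiemannHypothesis.Theorems.DBNDefs
import Literature.Analysis.SpecialFunctions.InvSqAddSqIntegral
import Mathlib.MeasureTheory.Integral.Prod
import HarnessLib

/-!
# RiemannHypothesis / DBN — kernel masses: T1b `ProbeMass`, `DescentMass`, T1c `NetWeightCeiling`, N1

RH-FREE real analysis on the objects of `Theorems/DBNDefs.lean` (column DBN of the RH ladder,
D-0040 record-keeping; THEORY-R1 §2–§3 of the `pub-dbn` cell).  Proved here, sorry-free, standard
axioms:

* the biweight bump: branch-free form, continuity, `0 ≤ φ ≤ 15/16`, unit mass `∫_{-1}^{1} φ = 1`;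
* Poisson masses on the line `∫ a/(u²+a²) du = π` (from the Mathlib-only leaf
  `Literature.Analysis.SpecialFunctions.InvSqAddSqIntegral`);
* `DescentMass_holds` : `∫_ℝ 4/(ξ²+4) dξ = 2π`;
* `integral_probeKernel_one` / `ProbeMass_holds` (T1b): `∫_ℝ S_{c,κ,u}(ξ,1) dξ = 2π` for `c > 1`
  — Fubini on `ℝ × (-1,1]` (`integrable_prod_iff'`: every `ξ`-section has mass `2π φ(v)`), then
  `∫φ = 1`; with `integrable_probeKernel_one`;
* `NetWeightCeiling_holds` (T1c): a 1-D admissible signed kernel has `Σ wᵢ ≤ 1` (integrate the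
  admissibility inequality: `2π Σ wᵢ ≤ 2π`);
* `DoubleRowInvisibility_holds` (N1, continuum form): the four masses `2π, π, 2π, 4π`.

`--supports stmt-RiemannHypothesis-0274`; nothing here bears on the truth of RH.
-/

noncomputable section

-- D-0017: `Summit.<S>.<S>.…` is the designed namespace of a single-problem summit.
set_option linter.dupNamespace false

open scoped Real
open MeasureTheory Set intervalIntegral

namespace Summit.RiemannHypothesis.RiemannHypothesis.Theorems.DbnTheory

/-! ## The biweight bump: closed form, continuity, bounds, unit mass -/

/-- `φ(v) = (15/16)·max(1-v²,0)²` — a branch-free form of `biweight`. [folklore] -/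
theorem biweight_eq_max (v : ℝ) : biweight v = (15/16) * (max (1 - v^2) 0)^2 := by
  unfold biweight
  split_ifs with h
  · have h1 : v^2 ≤ 1 := by
      obtain ⟨h₁, h₂⟩ := abs_le.mp h
      nlinarith
    rw [max_eq_left (by linarith)]
  · have h1 : 1 < v^2 := by
      have h' : 1 < |v| := lt_of_not_ge h
      have h2 : (1:ℝ) < |v|^2 := by nlinarith [abs_nonneg v]
      simpa [sq_abs] using h2
    rw [max_eq_right (by linarith)]
    ring

/-- `biweight` is continuous. [folklore] -/
theorem continuous_biweight : Continuous biweight := by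
  have h : biweight = fun v => (15/16) * (max (1 - v^2) 0)^2 := funext biweight_eq_max
  rw [h]
  exact continuous_const.mul (((continuous_const.sub (continuous_pow 2)).max continuous_const).pow 2)

/-- `0 ≤ φ`. [folklore] -/
theorem biweight_nonneg (v : ℝ) : 0 ≤ biweight v := by
  rw [biweight_eq_max]; positivity

/-- `φ ≤ 15/16`. [folklore] -/
theorem biweight_le (v : ℝ) : biweight v ≤ 15/16 := by
  rw [biweight_eq_max]
  have h0 : 0 ≤ max (1 - v^2) 0 := le_max_right _ _
  have h1 : max (1 - v^2) 0 ≤ 1 := max_le (by nlinarith [sq_nonneg v]) zero_le_one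
  have h2 : (max (1 - v^2) 0)^2 ≤ 1 := by nlinarith
  nlinarith

/-- `∫_{-1}^{1} φ = 1` (unit mass of the biweight). [folklore] -/
theorem integral_biweight : ∫ v in (-1:ℝ)..1, biweight v = 1 := by
  have hderiv : ∀ x ∈ uIcc (-1:ℝ) 1,
      HasDerivAt (fun v : ℝ => (15/16) * (v - 2 * v^3 / 3 + v^5 / 5)) (biweight x) x := by
    intro x hx
    rw [uIcc_of_le (by norm_num)] at hx
    have hx' : |x| ≤ 1 := abs_le.mpr ⟨hx.1, hx.2⟩
    have hb : biweight x = (15/16) * (1 - 2 * x^2 + x^4) := by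
      unfold biweight; rw [if_pos hx']; ring
    have h : HasDerivAt (fun v : ℝ => (15/16) * (v - 2 * v^3 / 3 + v^5 / 5))
        ((15/16 : ℝ) * (1 - 2 * (((3:ℕ) : ℝ) * x^(3-1)) / 3 + ((5:ℕ) : ℝ) * x^(5-1) / 5)) x :=
      (((hasDerivAt_id x).sub (((hasDerivAt_pow 3 x).const_mul 2).div_const 3)).add
        ((hasDerivAt_pow 5 x).div_const 5)).const_mul (15/16 : ℝ)
    refine h.congr_deriv ?_
    rw [hb]; norm_num; ring
  have hint : IntervalIntegrable biweight volume (-1) 1 := continuous_biweight.intervalIntegrable _ _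
  rw [integral_eq_sub_of_hasDerivAt hderiv hint]
  norm_num

/-! ## Poisson-kernel masses on the line -/

/-- `∫_ℝ a/(u² + a²) du = π` for `a > 0`. [folklore] -/
theorem integral_poisson {a : ℝ} (ha : 0 < a) : ∫ u : ℝ, a / (u^2 + a^2) = π := by
  simp_rw [div_eq_mul_inv]
  rw [MeasureTheory.integral_const_mul, Literature.Analysis.SpecialFunctions.integral_inv_sq_add_sq_eq_pi_div' ha]
  field_simp

/-- integrability of `u ↦ a/(u² + a²)` for `a > 0`. [folklore] -/
theorem integrable_poisson {a : ℝ} (ha : 0 < a) : Integrable fun u : ℝ => a / (u^2 + a^2) := by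
  simp_rw [div_eq_mul_inv]
  exact (Literature.Analysis.SpecialFunctions.integrable_inv_sq_add_sq_of_ne_zero' ha.ne').const_mul a

/-- `∫_ℝ a/(a² + (ξ - u - s)²) dξ = π` for `a > 0` (translated Poisson mass). [folklore] -/
theorem integral_poisson_shift {a : ℝ} (ha : 0 < a) (u s : ℝ) :
    ∫ ξ : ℝ, a / (a^2 + (ξ - u - s)^2) = π := by
  have h : (fun ξ : ℝ => a / (a^2 + (ξ - u - s)^2)) = fun ξ => a * (((u + s) - ξ)^2 + a^2)⁻¹ := by
    funext ξ; rw [div_eq_mul_inv]; congr 2; ring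
  rw [h, MeasureTheory.integral_const_mul,
    Literature.Analysis.SpecialFunctions.integral_inv_sub_sq_add_sq_eq_pi_div ha (u + s)]
  field_simp

/-- integrability of the translated Poisson kernel `ξ ↦ a/(a² + (ξ - u - s)²)`, `a > 0`. [folklore] -/
theorem integrable_poisson_shift {a : ℝ} (ha : 0 < a) (u s : ℝ) :
    Integrable fun ξ : ℝ => a / (a^2 + (ξ - u - s)^2) := by
  have h : (fun ξ : ℝ => a / (a^2 + (ξ - u - s)^2)) = fun ξ => a * (((u + s) - ξ)^2 + a^2)⁻¹ := by
    funext ξ; rw [div_eq_mul_inv]; congr 2; ring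
  rw [h]
  exact (Literature.Analysis.SpecialFunctions.integrable_inv_sub_sq_add_sq_of_ne_zero ha.ne' _).const_mul a

/-- **`DescentMass`**: `∫_ℝ 4/(ξ²+4) dξ = 2π`. [folklore] -/
theorem DescentMass_holds : DescentMass := by
  unfold DescentMass
  have h : (fun ξ : ℝ => (4:ℝ) / (ξ^2 + 4)) = fun ξ => 2 * (2 / (ξ^2 + 2^2)) := by
    funext ξ; norm_num; ring
  rw [h, MeasureTheory.integral_const_mul, integral_poisson (by norm_num : (0:ℝ) < 2)]

/-! ## The probe kernel on the boundary line `η = 1`: Fubini and mass `2π` -/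

section probe

variable {c : ℝ} (κ u : ℝ)

/-- the integrand of `probeKernel c κ u ξ 1` as a function of `(ξ, v)`, written out. -/
theorem probeKernel_one (c κ u ξ : ℝ) : probeKernel c κ u ξ 1 =
    ∫ v in (-1:ℝ)..1, biweight v * ((c - 1) / ((c - 1)^2 + (ξ - u - κ * v)^2)
      + (c + 1) / ((c + 1)^2 + (ξ - u - κ * v)^2)) := rfl

/-- For fixed `v`, the `ξ`-section of the boundary integrand is integrable with integral `2π·φ(v)`
(`c > 1`). [folklore] -/
theorem integral_probe_section (hc : 1 < c) (v : ℝ) :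
    Integrable (fun ξ : ℝ => biweight v * ((c - 1) / ((c - 1)^2 + (ξ - u - κ * v)^2)
      + (c + 1) / ((c + 1)^2 + (ξ - u - κ * v)^2))) ∧
    ∫ ξ : ℝ, biweight v * ((c - 1) / ((c - 1)^2 + (ξ - u - κ * v)^2)
      + (c + 1) / ((c + 1)^2 + (ξ - u - κ * v)^2)) = biweight v * (2 * π) := by
  have hc1 : 0 < c - 1 := by linarith
  have hc2 : 0 < c + 1 := by linarith
  have hi := (integrable_poisson_shift hc1 u (κ * v)).add (integrable_poisson_shift hc2 u (κ * v))
  refine ⟨hi.const_mul _, ?_⟩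
  rw [MeasureTheory.integral_const_mul, integral_add (integrable_poisson_shift hc1 u (κ * v))
    (integrable_poisson_shift hc2 u (κ * v)), integral_poisson_shift hc1, integral_poisson_shift hc2]
  ring

/-- Joint integrability of the boundary integrand on `ℝ × (-1,1]` (`c > 1`). [folklore] -/
theorem integrable_probe_prod (hc : 1 < c) :
    Integrable (fun p : ℝ × ℝ => biweight p.2 * ((c - 1) / ((c - 1)^2 + (p.1 - u - κ * p.2)^2)
      + (c + 1) / ((c + 1)^2 + (p.1 - u - κ * p.2)^2)))
      ((volume : Measure ℝ).prod (volume.restrict (Ioc (-1:ℝ) 1))) := by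
  have hc1 : 0 < c - 1 := by linarith
  have hc2 : 0 < c + 1 := by linarith
  have hcont : Continuous (fun p : ℝ × ℝ => biweight p.2 * ((c - 1) / ((c - 1)^2 + (p.1 - u - κ * p.2)^2)
      + (c + 1) / ((c + 1)^2 + (p.1 - u - κ * p.2)^2))) := by
    refine (continuous_biweight.comp continuous_snd).mul (Continuous.add ?_ ?_)
    · exact continuous_const.div (by fun_prop) (fun p => by positivity)
    · exact continuous_const.div (by fun_prop) (fun p => by positivity)
  rw [integrable_prod_iff' hcont.aestronglyMeasurable]
  refine ⟨Filter.Eventually.of_forall fun v => (integral_probe_section κ u hc v).1, ?_⟩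
  have h : (fun v : ℝ => ∫ ξ : ℝ, ‖biweight v * ((c - 1) / ((c - 1)^2 + (ξ - u - κ * v)^2)
      + (c + 1) / ((c + 1)^2 + (ξ - u - κ * v)^2))‖) = fun v => biweight v * (2 * π) := by
    funext v
    rw [← (integral_probe_section κ u hc v).2]
    congr 1; funext ξ
    rw [Real.norm_of_nonneg]
    have := biweight_nonneg v
    positivity
  rw [h]
  exact ((continuous_biweight.mul continuous_const).integrableOn_Icc).mono_set Ioc_subset_Icc_self

/-- **Mass of the smeared probe on the boundary line**: `∫_ℝ S_{c,κ,u}(ξ,1) dξ = 2π` for `c > 1`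
(Fubini; each `ξ`-section has mass `2π φ(v)` and `∫φ = 1`). [folklore] -/
theorem integral_probeKernel_one (hc : 1 < c) : ∫ ξ, probeKernel c κ u ξ 1 = 2 * π := by
  have hF := integrable_probe_prod κ u hc
  calc ∫ ξ, probeKernel c κ u ξ 1
      = ∫ ξ, ∫ v in Ioc (-1:ℝ) 1, biweight v * ((c - 1) / ((c - 1)^2 + (ξ - u - κ * v)^2)
          + (c + 1) / ((c + 1)^2 + (ξ - u - κ * v)^2)) := by
        congr 1; funext ξ; rw [probeKernel_one, intervalIntegral.integral_of_le (by norm_num)]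
    _ = ∫ v in Ioc (-1:ℝ) 1, ∫ ξ, biweight v * ((c - 1) / ((c - 1)^2 + (ξ - u - κ * v)^2)
          + (c + 1) / ((c + 1)^2 + (ξ - u - κ * v)^2)) := integral_integral_swap hF
    _ = ∫ v in Ioc (-1:ℝ) 1, biweight v * (2 * π) := by
        congr 1; funext v; exact (integral_probe_section κ u hc v).2
    _ = (∫ v in (-1:ℝ)..1, biweight v) * (2 * π) := by
        rw [MeasureTheory.integral_mul_const, intervalIntegral.integral_of_le (by norm_num)]
    _ = 2 * π := by rw [integral_biweight, one_mul]

/-- `ξ ↦ S_{c,κ,u}(ξ,1)` is integrable on `ℝ` (`c > 1`). [folklore] -/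
theorem integrable_probeKernel_one (hc : 1 < c) : Integrable fun ξ => probeKernel c κ u ξ 1 := by
  have h := (integrable_probe_prod κ u hc).integral_prod_left
  refine h.congr (Filter.Eventually.of_forall fun ξ => ?_)
  simp only
  rw [probeKernel_one, intervalIntegral.integral_of_le (by norm_num)]

end probe

/-- **`ProbeMass`** (T1b): `∫_ℝ S_{c,κ,u}(ξ,1) dξ = 2π` for `c > 1`, `κ ≥ 0` (the smear sign plays no
role). [folklore] -/
theorem ProbeMass_holds : ProbeMass := fun _ κ u hc _ => integral_probeKernel_one κ u hc

/-- **`NetWeightCeiling`** (T1c): a 1-D admissible signed kernel has net weight `Σ wᵢ ≤ 1`: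
integrate `k(·,1) ≤ 4/(ξ²+4)` over `ℝ`; the left side has mass `2π Σ wᵢ` (T1b), the right side `2π`.
[folklore] -/
theorem NetWeightCeiling_holds : NetWeightCeiling := by
  intro n w c κ u hc _ hadm
  have hL : Integrable (fun ξ => signedKernel w c κ u ξ 1) := by
    unfold signedKernel
    exact integrable_finsetSum _ fun i _ => (integrable_probeKernel_one (κ i) (u i) (hc i)).const_mul _
  have hR : Integrable (fun ξ : ℝ => (4:ℝ) / (ξ^2 + 4)) := by
    have h : (fun ξ : ℝ => (4:ℝ) / (ξ^2 + 4)) = fun ξ => 2 * (2 / (ξ^2 + 2^2)) := by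
      funext ξ; norm_num; ring
    rw [h]; exact (integrable_poisson (by norm_num : (0:ℝ) < 2)).const_mul 2
  have hmono := integral_mono hL hR fun ξ => hadm ξ
  have hLval : ∫ ξ, signedKernel w c κ u ξ 1 = (∑ i, w i) * (2 * π) := by
    unfold signedKernel
    rw [integral_finsetSum _ fun i _ => (integrable_probeKernel_one (κ i) (u i) (hc i)).const_mul _,
      Finset.sum_mul]
    refine Finset.sum_congr rfl fun i _ => ?_
    rw [MeasureTheory.integral_const_mul, integral_probeKernel_one (κ i) (u i) (hc i)]
  have hRval : ∫ ξ : ℝ, (4:ℝ) / (ξ^2 + 4) = 2 * π := DescentMass_holds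
  rw [hLval, hRval] at hmono
  nlinarith [Real.pi_pos]

/-- **`DoubleRowInvisibility`** (N1, continuum form): the four Poisson masses `2π, π, 2π, 4π`. [folklore] -/
theorem DoubleRowInvisibility_holds : DoubleRowInvisibility := by
  intro ys Y hY hYs
  have h1 : 0 < ys - Y := by linarith
  have h2 : 0 < ys + Y := by linarith
  have h3 : 0 < ys := by linarith
  have h4 : 0 < 2 * Y := by linarith
  refine ⟨?_, integral_poisson h3, ?_, ?_⟩
  · rw [integral_add (integrable_poisson h1) (integrable_poisson h2), integral_poisson h1,
      integral_poisson h2]; ring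
  · have h : (fun u : ℝ => 4 * Y / (u^2 + (2 * Y)^2)) = fun u => 2 * (2 * Y / (u^2 + (2 * Y)^2)) := by
      funext u; ring
    rw [h, MeasureTheory.integral_const_mul, integral_poisson h4]
  · have h : (fun u : ℝ => (2:ℝ) * (2 * Y / (u^2 + Y^2))) = fun u => 4 * (Y / (u^2 + Y^2)) := by
      funext u; ring
    rw [h, MeasureTheory.integral_const_mul, integral_poisson hY]

end Summit.RiemannHypothesis.RiemannHypothesis.Theorems.DbnTheory

end
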